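import Mathlib.Topology.Algebra.ClopenNhdofOne
import Mathlib.Topology.Algebra.ContinuousMonoidHom
import Mathlib.GroupTheory.Commutator.Basic
import Mathlib.Tactic.Group

/-!
# Subquotients of profinite groups along isomorphisms (toolkit for [CombGC] §1)

Mochizuki, *A combinatorial version of the Grothendieck conjecture*, Tohoku Math. J. **59** (2007),
§1 [cite: MochizukiCombGC2007, Def 1.4 p.10]: the filtration-preserving isomorphisms of Definition
1.4 (iii) transport the subquotients `M^vert_{G'}`, `M^edge_{G'}`, `M_{G'}/M^vert_{G'}` (= `U / V` for
subgroups `V ≤ U` of `Π_G` containing `[U, U]`) of corresponding finite étale coverings along an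
isomorphism of profinite groups; the proofs of Theorem 1.6 (ii)(iii) (p. 14) compare their ranks.
The generic profinite-group facts this needs (Ribes–Zalesskii, *Profinite Groups*, Prop. 2.2.1 for
quotients by closed normal subgroups [cite: RibesZalesskii2010, Prop 2.2.1]) are collected here,
Mathlib-only, for the abc-iut cell's [CombGC] Theorem 1.6 sub-DAG (rows T16-L08/L16):

* `normal_subgroupOf_of_commutator_le` — `V ∩ U` is normal in `U` once `[U, U] ⊆ V`;
* `compactSpace_of_isClosed`, `totallyDisconnectedSpace_quotient` — closed subgroups of compact
  groups are compact; quotients of profinite groups by closed normal subgroups are totally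
  disconnected (the same statement as `AbsoluteAnabelian.LocalReciprocityCofinal`'s
  `QuotientGroup.totallyDisconnectedSpace_of_isClosed`, repeated here to avoid its imports);
* `nonempty_continuousMulEquiv_quotient_of_surjective` — a continuous surjective homomorphism from
  a compact group onto a Hausdorff group with kernel `N` induces `A ⧸ N ≃ₜ* Z`;
* `nonempty_continuousMulEquiv_subquotient_map` — a topological isomorphism `α : A ≃ₜ* B` of compact
  groups induces `U / (V ∩ U) ≃ₜ* α(U) / (α(V) ∩ α(U))` for closed `V`, `U`.

No statement of the paper is asserted; nothing here takes a side on [IUTchIII] Cor. 3.12.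
-/

namespace Literature.GroupTheory.ProfiniteSubquotients

open scoped Pointwise

universe u

variable {A : Type u} [Group A]

/-- `V ∩ U` is a normal subgroup of `U` as soon as `[U, U] ⊆ V` (e.g. the filtration subgroups
`M^vert`, `M^edge`, `M^cusp` of [CombGC] Def. 1.1 (ii), which contain `\overline{[U,U]}`).
[cite: MochizukiCombGC2007, Def 1.1(ii) p.7] -/
theorem normal_subgroupOf_of_commutator_le {U V : Subgroup A} (h : ⁅U, U⁆ ≤ V) :
    (V.subgroupOf U).Normal := by
  refine ⟨fun n hn g => ?_⟩
  rw [Subgroup.mem_subgroupOf] at hn ⊢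
  have hc : (g : A) * n * (g : A)⁻¹ * (n : A)⁻¹ ∈ V :=
    h (Subgroup.commutator_mem_commutator g.2 n.2)
  simpa using V.mul_mem hc hn

variable [TopologicalSpace A]

/-- A closed subgroup of a compact group is compact. [cite: RibesZalesskii2010, Prop 2.2.1] -/
theorem compactSpace_of_isClosed [CompactSpace A] {U : Subgroup A} (hU : IsClosed (U : Set A)) :
    CompactSpace U :=
  isCompact_iff_compactSpace.mp hU.isCompact

variable [IsTopologicalGroup A]

/-- An open subgroup of a compact group is compact. [cite: RibesZalesskii2010, Prop 2.2.1] -/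
theorem compactSpace_of_isOpen [CompactSpace A] {U : Subgroup A} (hU : IsOpen (U : Set A)) :
    CompactSpace U :=
  compactSpace_of_isClosed (Subgroup.isClosed_of_isOpen U hU)

/-- The quotient of a compact totally disconnected group by a CLOSED normal subgroup is totally
disconnected (hence profinite): distinct cosets `gN ≠ g'N` are separated by the clopen image of
`g · (K ⊔ N)` for an open normal `K` with `K⁻¹ · g⁻¹g' ∩ N = ∅`. [cite: RibesZalesskii2010, Prop 2.2.1] -/
theorem totallyDisconnectedSpace_quotient [CompactSpace A] [TotallyDisconnectedSpace A]
    (N : Subgroup A) [N.Normal] (hN : IsClosed (N : Set A)) : TotallyDisconnectedSpace (A ⧸ N) := by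
  haveI : TotallySeparatedSpace (A ⧸ N) := by
    rw [totallySeparatedSpace_iff_exists_isClopen]
    intro x y hxy
    obtain ⟨g, rfl⟩ := QuotientGroup.mk_surjective x
    obtain ⟨g', rfl⟩ := QuotientGroup.mk_surjective y
    set h : A := g⁻¹ * g' with hh
    have hhN : h ∉ N := fun hmem => hxy (QuotientGroup.eq.mpr hmem)
    let O : Set A := (fun k : A => k * h) ⁻¹' (N : Set A)ᶜ
    have hO : IsOpen O := hN.isOpen_compl.preimage (continuous_id.mul continuous_const)
    have h1O : (1 : A) ∈ O := by
      change 1 * h ∈ (N : Set A)ᶜ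
      rw [one_mul]; exact hhN
    obtain ⟨K, hK⟩ := ProfiniteGrp.exist_openNormalSubgroup_sub_open_nhds_of_one hO h1O
    let S : Subgroup A := K.toSubgroup ⊔ N
    have hSopen : IsOpen (S : Set A) := Subgroup.isOpen_mono le_sup_left K.isOpen'
    have hSclosed : IsClosed (S : Set A) := Subgroup.isClosed_of_isOpen _ hSopen
    refine ⟨QuotientGroup.mk '' (g • (S : Set A)), ⟨?_, ?_⟩, ?_, ?_⟩
    · exact QuotientGroup.isClosedMap_coe hN.isCompact _ (hSclosed.smul g)
    · exact QuotientGroup.isOpenMap_coe _ (hSopen.smul g)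
    · exact ⟨g, ⟨1, S.one_mem, by simp⟩, rfl⟩
    · rintro ⟨s, ⟨t, ht, rfl⟩, hs⟩
      have hmem : (g • t)⁻¹ * g' ∈ N := QuotientGroup.eq.mp hs
      have ht' : h ∈ (S : Set A) := by
        have h2 : h = t * ((g • t)⁻¹ * g') := by
          rw [hh, smul_eq_mul, mul_inv_rev]; group
        rw [h2]
        exact S.mul_mem ht (Subgroup.mem_sup_right hmem)
      rw [Subgroup.mul_normal] at ht'
      obtain ⟨k, hk, n, hn, hkn⟩ := ht'
      have hk' : k⁻¹ ∈ O := hK (K.toSubgroup.inv_mem hk)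
      apply hk'
      change k⁻¹ * h ∈ (N : Set A)
      rw [← hkn, inv_mul_cancel_left]
      exact hn
  infer_instance

omit [IsTopologicalGroup A] in
/-- **First isomorphism theorem, topological form (compact-to-Hausdorff).**  A continuous surjective
homomorphism `f` from a compact group onto a Hausdorff group whose kernel is `N` induces a
topological isomorphism `A ⧸ N ≃ₜ* Z` (`e (a N) = f a`). [cite: RibesZalesskii2010, Prop 2.2.1] -/
theorem nonempty_continuousMulEquiv_quotient_of_surjective [CompactSpace A] {Z : Type u} [Group Z]
    [TopologicalSpace Z] [T2Space Z] (f : A →* Z) (hf : Continuous f)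
    (hsurj : Function.Surjective f) (N : Subgroup A) [N.Normal] (hN : f.ker = N) :
    ∃ e : A ⧸ N ≃ₜ* Z, ∀ a : A, e (QuotientGroup.mk a) = f a := by
  let e : A ⧸ N ≃* Z :=
    (QuotientGroup.quotientMulEquivOfEq hN.symm).trans
      (QuotientGroup.quotientKerEquivOfSurjective f hsurj)
  have he : ∀ a : A, e (QuotientGroup.mk a) = f a := fun a => by
    simp only [e, MulEquiv.trans_apply, QuotientGroup.quotientMulEquivOfEq_mk,
      QuotientGroup.quotientKerEquivOfSurjective, QuotientGroup.quotientKerEquivOfRightInverse_apply,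
      QuotientGroup.kerLift_mk]
  have hcont : Continuous e := by
    rw [(QuotientGroup.isQuotientMap_mk N).continuous_iff]
    have : (e : A ⧸ N → Z) ∘ QuotientGroup.mk = f := funext he
    rw [this]; exact hf
  let h : A ⧸ N ≃ₜ Z := hcont.homeoOfEquivCompactToT2 (f := e.toEquiv)
  exact ⟨{ e with continuous_toFun := hcont, continuous_invFun := h.continuous_symm }, he⟩

omit [IsTopologicalGroup A] in
/-- **Transport of subquotients along a topological isomorphism.**  For `α : A ≃ₜ* B` between compact
groups, a closed subgroup `U ≤ A` and a closed `V ≤ A` with `V ∩ U ⊴ U` and `α(V) ∩ α(U) ⊴ α(U)`, the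
isomorphism `α` induces a topological isomorphism `U / (V ∩ U) ≃ₜ* α(U) / (α(V) ∩ α(U))` sending the
class of `u` to the class of `α u` — the transport of the subquotients `M^vert_{G'}`, … of [CombGC]
Def. 1.4 (iii) along `α : Π_G ⥲ Π_H`. [cite: MochizukiCombGC2007, Def 1.4(iii) p.10] -/
theorem nonempty_continuousMulEquiv_subquotient_map [CompactSpace A] {B : Type u} [Group B]
    [TopologicalSpace B] [IsTopologicalGroup B] (α : A ≃ₜ* B) {U V : Subgroup A}
    (hU : IsClosed (U : Set A)) (hV : IsClosed (V : Set A)) [(V.subgroupOf U).Normal]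
    [((V.map α.toMulEquiv.toMonoidHom).subgroupOf (U.map α.toMulEquiv.toMonoidHom)).Normal] :
    ∃ e : (U ⧸ V.subgroupOf U) ≃ₜ*
        (↥(U.map α.toMulEquiv.toMonoidHom) ⧸
          (V.map α.toMulEquiv.toMonoidHom).subgroupOf (U.map α.toMulEquiv.toMonoidHom)),
      ∀ u : U, e (QuotientGroup.mk u) =
        QuotientGroup.mk (α.toMulEquiv.toMonoidHom.subgroupMap U u) := by
  set αm := α.toMulEquiv.toMonoidHom with hαm
  set U' : Subgroup B := U.map αm with hU'
  set V' : Subgroup B := V.map αm with hV'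
  haveI : CompactSpace U := compactSpace_of_isClosed hU
  -- the target is Hausdorff: `α(V)` is closed
  have hV'c : IsClosed (V' : Set B) := by
    rw [hV', Subgroup.coe_map]
    exact α.toHomeomorph.isClosedMap _ hV
  haveI : IsClosed (((V'.subgroupOf U') : Subgroup U') : Set U') := hV'c.preimage continuous_subtype_val
  let f : U →* U' ⧸ V'.subgroupOf U' := (QuotientGroup.mk' (V'.subgroupOf U')).comp (αm.subgroupMap U)
  have hfc : Continuous f := by
    refine QuotientGroup.continuous_mk.comp (continuous_induced_rng.mpr ?_)
    exact α.continuous.comp continuous_subtype_val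
  have hfs : Function.Surjective f :=
    (QuotientGroup.mk'_surjective _).comp (αm.subgroupMap_surjective U)
  have hfk : f.ker = V.subgroupOf U := by
    ext u
    rw [MonoidHom.mem_ker, MonoidHom.comp_apply, QuotientGroup.mk'_apply, QuotientGroup.eq_one_iff,
      Subgroup.mem_subgroupOf, Subgroup.mem_subgroupOf, MonoidHom.subgroupMap_apply_coe, hV',
      Subgroup.mem_map]
    constructor
    · rintro ⟨v, hv, hvu⟩
      have : v = (u : A) := α.injective hvu
      rwa [← this]
    · exact fun hu => ⟨u, hu, rfl⟩
  obtain ⟨e, he⟩ := nonempty_continuousMulEquiv_quotient_of_surjective f hfc hfs _ hfk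
  exact ⟨e, fun u => he u⟩

end Literature.GroupTheory.ProfiniteSubquotients
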